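import Literature.NumberTheory.Transcendental.AyoubRelativeAlgebraicity

/-!
# Ayoub's relative Kontsevich–Zagier theorem revisited — Stokes on the square and an
# infinite-rank instance of Théorème 1.7 `⇒`

Theorems (and four small honest definitions: `zvar`, `geomSeries`, `oddGeom`, `homotopyQ`) on
top of `Literature/NumberTheory/Transcendental/AyoubRelative.lean` (the objects and the NAMED
FACT `Literature.NumberTheory.Transcendental.AyoubRel.ayoub_relativeKZ_revisited` = J. Ayoub,
*La version relative de la conjecture des périodes de Kontsevich–Zagier revisitée*, Tohoku Math.
J. (2) 71 (2019) 465–485, **Théorème 1.7**) and `…/AyoubRelativeAlgebraicity.lean` (`𝒪†_alg` is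
a subalgebra; derivations and restrictions preserve it).

Write `𝒪 = k[z, t, t⁻¹]`, `𝒪†_alg ⊂ 𝒪((ϖ))` (Notation 1.6), `∫` for term-by-term integration (5),
`gens` for the generators (a) `gen_a(i, G) = ∂G/∂zᵢ - G|_{zᵢ=1} + G|_{zᵢ=0}`, (b) `tⱼ∂H/∂tⱼ`
(`G, H ∈ 𝒪†_alg`). Théorème 1.7: `ker ∫ ∩ 𝒪†_alg = span_k gens`. The inclusion `⊆` is the deep
(motivic, note §2) content and stays a named fact; `…Proofs.lean` / `…FiniteRank.lean` prove it
for series whose `ϖ`-coefficients span a finite-dimensional subspace of `𝒪`.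

## What is proved here (elementary; not in the note)

1. **Stokes on the unit square as a relation** (`stokes_square_mem_span`): if `K, L ∈ 𝒪†_alg`
   satisfy `∂K/∂zⱼ = ∂L/∂zᵢ` (the algebraic 1-form `ω = K dzᵢ + L dzⱼ` is closed), then
   `K|_{zⱼ=0} - K|_{zⱼ=1} - L|_{zᵢ=0} + L|_{zᵢ=1} = gen_a(j, K) - gen_a(i, L) ∈ span_k gens`
   — the algebraic shadow of `∮_{∂[0,1]²} ω = 0`. Trivial, but it is the mechanism by which an
   AUXILIARY variable `zⱼ` certifies relations in `zᵢ` that no single generator in `zᵢ` gives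
   (Ayoub's formulation has no change-of-variables generator, cf. Remarque 1.8).
2. **An infinite-rank instance of the hard inclusion** (`oddGeom_mem_span_ayoubGenerators`):
   `F = ∑ₙ ϖⁿ (2zᵢ-1)^{2n+1} = (2zᵢ-1)/(1 - ϖ(2zᵢ-1)²) ∈ 𝒪†_alg` has `∫ F = 0` (odd about
   `zᵢ = 1/2`), and its coefficients have unbounded degree, so it is OUTSIDE the finite-rank
   theorem (`oddGeom_not_supported`; the docstring of `…FiniteRank.lean` names exactly this `F`
   as not covered there). It IS in `span_k gens`, over any field, by the explicit two-variable
   certificate (`j ≠ i` auxiliary, `w = 2zᵢ-1`, `q = zⱼ + (1-zⱼ)w²`, `oddGeom_eq_certificate`):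
   `F = gen_a(i, G₁) + gen_a(j, G₂)`, `G₁ = -zᵢ(1-zᵢ)/(1-ϖq)`, `G₂ = (1-zⱼ)w/(1-ϖq)`,
   i.e. `(K, L) = (-4ϖG₂, 4ϖG₁) = d log(1 - ϖq)` for the linear homotopy `q` contracting the
   null-homologous loop `w ↦ 1 - ϖw²`, `w ∈ [-1,1]`, to a point. Coefficientwise it is the
   polynomial identity `gen_a(i, -zᵢ(1-zᵢ)qⁿ) + gen_a(j, (1-zⱼ)wqⁿ) = w(w²)ⁿ`
   (`certificate_coeff`), resting on `1 - w² = 4zᵢ(1-zᵢ)`.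
   (One auxiliary variable is NECESSARY here: with `zᵢ` alone, `gen_a(i, G) = F` forces the
   central coefficient of `G` to be `-log(1-ϖw²)/(4ϖ) + αzᵢ + β`, which is not the central
   coefficient of an algebraic series — informal remark, not formalised.)

## References

* J. Ayoub, *La version relative de la conjecture des périodes de Kontsevich–Zagier revisitée*,
  Tohoku Math. J. (2) 71 (2019) 465–485, doi:10.2748/tmj/1568772181; author's preprint
  `https://user.math.uzh.ch/ayoub/PDF-Files/rel-KZ-bis.pdf`, §1.2: Notation 1.6, Théorème 1.7,
  Remarque 1.8 (bib key `AyoubRelKZRevisited`).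
* M. Kontsevich, D. Zagier, *Periods*, in: Mathematics Unlimited — 2001 and Beyond, Springer
  (2001), §1.1 (the Stokes and change-of-variables rules).
-/

noncomputable section

open Polynomial

namespace Literature.NumberTheory.Transcendental.AyoubRel

variable {k : Type} [Field k]

/-! ### 1. Stokes on the square -/

/-- **Stokes' formula on `[0,1]²` as a relation.** For `K, L ∈ 𝒪†_alg` with `∂K/∂zⱼ = ∂L/∂zᵢ`
(coefficientwise in `ϖ`: the algebraic 1-form `ω = K dzᵢ + L dzⱼ` is closed), the "boundary of
the square" `K|_{zⱼ=0} - K|_{zⱼ=1} - L|_{zᵢ=0} + L|_{zᵢ=1}` equals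
`(∂ⱼK - K|_{zⱼ=1} + K|_{zⱼ=0}) - (∂ᵢL - L|_{zᵢ=1} + L|_{zᵢ=0})`, a difference of two type (a)
generators, hence lies in `span_k gens` (`∮_{∂[0,1]²} ω = 0`). [folklore] -/
theorem stokes_square_mem_span (i j : ℕ) {K L : LaurentSeries (O k)} (hK : K ∈ Odagger k)
    (hL : L ∈ Odagger k) (hclosed : mapCoeff k (dz k j) K = mapCoeff k (dz k i) L) :
    mapCoeff k (restr k j 0) K - mapCoeff k (restr k j 1) K - mapCoeff k (restr k i 0) L +
        mapCoeff k (restr k i 1) L ∈ Submodule.span k (ayoubGenerators k) := by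
  have key : mapCoeff k (restr k j 0) K - mapCoeff k (restr k j 1) K - mapCoeff k (restr k i 0) L +
      mapCoeff k (restr k i 1) L = mapCoeff k (relA k j) K - mapCoeff k (relA k i) L := by
    simp only [relA, mapCoeff_add_map, mapCoeff_sub_map, hclosed]
    abel
  rw [key]
  exact Submodule.sub_mem _ (Submodule.subset_span (Or.inl ⟨K, hK, j, rfl⟩))
    (Submodule.subset_span (Or.inl ⟨L, hL, i, rfl⟩))

/-- **Stokes certificate.** If moreover `K` vanishes on the edge `zⱼ = 1` and `L` on the two edges
`zᵢ = 0`, `zᵢ = 1`, then the remaining edge `K|_{zⱼ=0}` is in `span_k gens`. (This is how an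
auxiliary variable `zⱼ` certifies a relation in the variable `zᵢ`.) [folklore] -/
theorem mem_span_of_stokes_certificate (i j : ℕ) {F K L : LaurentSeries (O k)} (hK : K ∈ Odagger k)
    (hL : L ∈ Odagger k) (hclosed : mapCoeff k (dz k j) K = mapCoeff k (dz k i) L)
    (h0 : mapCoeff k (restr k j 0) K = F) (h1 : mapCoeff k (restr k j 1) K = 0)
    (h2 : mapCoeff k (restr k i 0) L = 0) (h3 : mapCoeff k (restr k i 1) L = 0) :
    F ∈ Submodule.span k (ayoubGenerators k) := by
  have h := stokes_square_mem_span i j hK hL hclosed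
  rwa [h0, h1, h2, h3, sub_zero, sub_zero, add_zero] at h

/-! ### 2. Calculus on `𝒪`: the variables `zᵢ`, power rule, restriction of powers -/

variable (k) in
/-- The variable `zᵢ` as an element of `𝒪 = k[z, t, t⁻¹]`. [folklore] -/
def zvar (i : ℕ) : O k := mono k (Finsupp.single i 1, 0)

/-- `∂zᵢ/∂zᵢ = 1`. [folklore] -/
@[simp] theorem dz_zvar_self (i : ℕ) : dz k i (zvar k i) = 1 := by
  rw [zvar, dz_mono]
  simp only [Finsupp.single_eq_same, Nat.cast_one, one_smul, tsub_self]
  exact mono_zero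

/-- `∂zⱼ/∂zᵢ = 0` for `j ≠ i`. [folklore] -/
theorem dz_zvar_of_ne {i j : ℕ} (h : j ≠ i) : dz k i (zvar k j) = 0 := by
  rw [zvar, dz_mono]
  dsimp only
  rw [Finsupp.single_apply, if_neg h, Nat.cast_zero, zero_smul]

/-- `∂1/∂zᵢ = 0`. [folklore] -/
@[simp] theorem dz_one (i : ℕ) : dz k i (1 : O k) = 0 :=
  map_one_of_leibniz _ (dz_mul i)

/-- `∂c/∂zᵢ = 0` for scalars `c ∈ k`. [folklore] -/
@[simp] theorem dz_algebraMap (i : ℕ) (c : k) : dz k i (algebraMap k (O k) c) = 0 := by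
  rw [Algebra.algebraMap_eq_smul_one, map_smul, dz_one, smul_zero]

/-- `∂(n : 𝒪)/∂zᵢ = 0` for numerals. [folklore] -/
@[simp] theorem dz_natCast (i n : ℕ) : dz k i (n : O k) = 0 := by
  rw [← map_natCast (algebraMap k (O k)), dz_algebraMap]

/-- `∂(n : 𝒪)/∂zᵢ = 0` for numeric literals `n ≥ 2`. [folklore] -/
@[simp] theorem dz_ofNat (i n : ℕ) [n.AtLeastTwo] : dz k i (ofNat(n) : O k) = 0 := by
  rw [← Nat.cast_ofNat, dz_natCast]

/-- Power rule for `∂/∂zᵢ`. [folklore] -/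
theorem dz_pow_succ (i : ℕ) (f : O k) (n : ℕ) :
    dz k i (f ^ (n + 1)) = (n + 1 : O k) * f ^ n * dz k i f := by
  induction n with
  | zero => rw [zero_add, pow_one, pow_zero, Nat.cast_zero, zero_add, one_mul, one_mul]
  | succ n ih =>
    rw [pow_succ, dz_mul, ih]
    push_cast
    ring

/-- `zᵢ|_{zᵢ=c} = c`. [folklore] -/
@[simp] theorem restr_zvar_self (i : ℕ) (c : k) : restr k i c (zvar k i) = algebraMap k (O k) c := by
  rw [zvar, restr_mono]
  dsimp only
  rw [Finsupp.single_eq_same, pow_one, Finsupp.erase_single, Algebra.algebraMap_eq_smul_one,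
    ← mono_zero]
  rfl

/-- `zⱼ|_{zᵢ=c} = zⱼ` for `j ≠ i`. [folklore] -/
theorem restr_zvar_of_ne {i j : ℕ} (h : j ≠ i) (c : k) : restr k i c (zvar k j) = zvar k j := by
  rw [zvar, restr_mono]
  dsimp only
  rw [Finsupp.single_apply, if_neg h, pow_zero, one_smul, Finsupp.erase_of_notMem_support]
  rw [Finsupp.mem_support_iff, Finsupp.single_apply, if_neg h]
  exact fun h0 => h0 rfl

/-- `(f^n)|_{zᵢ=c} = (f|_{zᵢ=c})^n`. [folklore] -/
theorem restr_pow (i : ℕ) (c : k) (f : O k) (n : ℕ) : restr k i c (f ^ n) = restr k i c f ^ n :=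
  map_pow (AlgHom.ofLinearMap (restr k i c) (restr_one i c) (restr_mul i c)) f n

/-- `c'|_{zᵢ=c} = c'` for scalars. [folklore] -/
@[simp] theorem restr_algebraMap (i : ℕ) (c c' : k) :
    restr k i c (algebraMap k (O k) c') = algebraMap k (O k) c' :=
  AlgHom.commutes (AlgHom.ofLinearMap (restr k i c) (restr_one i c) (restr_mul i c)) c'

/-- `(n : 𝒪)|_{zᵢ=c} = n` for numerals. [folklore] -/
@[simp] theorem restr_natCast (i : ℕ) (c : k) (n : ℕ) : restr k i c (n : O k) = n :=
  map_natCast (AlgHom.ofLinearMap (restr k i c) (restr_one i c) (restr_mul i c)) n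

/-- `(n : 𝒪)|_{zᵢ=c} = n` for numeric literals `n ≥ 2`. [folklore] -/
@[simp] theorem restr_ofNat (i : ℕ) (c : k) (n : ℕ) [n.AtLeastTwo] :
    restr k i c (ofNat(n) : O k) = ofNat(n) := by
  rw [← Nat.cast_ofNat, restr_natCast]

/-! ### 3. Geometric series `a · ∑ₙ ϖⁿ qⁿ = a / (1 - ϖ q)` are algebraic -/

variable (k) in
/-- The geometric Laurent series `a/(1 - ϖq) := ∑ₙ a qⁿ ϖⁿ ∈ 𝒪((ϖ))` for `a, q ∈ 𝒪` (a rational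
function of `ϖ` with polynomial coefficients). [folklore] -/
def geomSeries (a q : O k) : LaurentSeries (O k) :=
  HahnSeries.ofPowerSeries ℤ (O k) (PowerSeries.mk fun n => a * q ^ n)

/-- Coefficients of the geometric series in non-negative degrees. [folklore] -/
@[simp] theorem geomSeries_coeff_natCast (a q : O k) (n : ℕ) :
    (geomSeries k a q).coeff (n : ℤ) = a * q ^ n := by
  rw [geomSeries, HahnSeries.ofPowerSeries_apply_coeff, PowerSeries.coeff_mk]

/-- A power series, seen in `𝒪((ϖ))`, has no terms of negative degree. [folklore] -/
theorem ofPowerSeries_coeff_negSucc (x : PowerSeries (O k)) (n : ℕ) :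
    (HahnSeries.ofPowerSeries ℤ (O k) x).coeff (Int.negSucc n) = 0 := by
  rw [HahnSeries.ofPowerSeries_apply]
  refine HahnSeries.embDomain_notin_range ?_
  rintro ⟨m, hm⟩
  exact (Int.negSucc_not_nonneg n).mp (hm ▸ Int.natCast_nonneg m)

/-- Coefficients of the geometric series in negative degrees vanish. [folklore] -/
@[simp] theorem geomSeries_coeff_negSucc (a q : O k) (n : ℕ) :
    (geomSeries k a q).coeff (Int.negSucc n) = 0 :=
  ofPowerSeries_coeff_negSucc _ n

/-- The defining equation `(1 - ϖ q) · (a/(1 - ϖq)) = a` in `𝒪((ϖ))`. [folklore] -/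
theorem one_sub_mul_geomSeries (a q : O k) :
    (1 - HahnSeries.single 1 q) * geomSeries k a q = HahnSeries.C a := by
  have hX : (HahnSeries.single 1 q : LaurentSeries (O k)) =
      HahnSeries.ofPowerSeries ℤ (O k) (PowerSeries.C q * PowerSeries.X) := by
    rw [map_mul, HahnSeries.ofPowerSeries_C, HahnSeries.ofPowerSeries_X, HahnSeries.C_apply,
      HahnSeries.single_mul_single, zero_add, mul_one]
  have hps : (1 - PowerSeries.C q * PowerSeries.X : PowerSeries (O k)) *
      PowerSeries.mk (fun n => a * q ^ n) = PowerSeries.C a := by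
    ext n
    rcases Nat.eq_zero_or_pos n with rfl | hn
    · simp [sub_mul]
    · obtain ⟨m, rfl⟩ : ∃ m, n = m + 1 := ⟨n - 1, by omega⟩
      rw [sub_mul, one_mul, map_sub, PowerSeries.coeff_mk, mul_assoc, PowerSeries.coeff_C_mul,
        PowerSeries.coeff_succ_X_mul, PowerSeries.coeff_mk, PowerSeries.coeff_C,
        if_neg (Nat.succ_ne_zero m), pow_succ]
      ring
  rw [geomSeries, hX, ← HahnSeries.ofPowerSeries_C, ← hps]
  simp only [map_mul, map_sub, map_one]

/-- **Geometric series are algebraic**: `a/(1 - ϖq) ∈ 𝒪†_alg` (it satisfies the degree-one equation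
`(1 - ϖq) Y = a` over `𝒪[ϖ]`, and `1 - ϖ q ≠ 0`). [folklore] -/
theorem geomSeries_mem_odagger (a q : O k) : geomSeries k a q ∈ Odagger k := by
  rw [mem_odagger_iff]
  set y : LaurentSeries (O k) := algebraMap (Polynomial (O k)) (LaurentSeries (O k)) (1 - X * Polynomial.C q)
    with hy
  have hy' : y = 1 - HahnSeries.single 1 q := by
    rw [hy, map_sub, map_one, Polynomial.algebraMap_hahnSeries_apply, Polynomial.coe_mul,
      Polynomial.coe_X, Polynomial.coe_C, map_mul, HahnSeries.ofPowerSeries_X,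
      HahnSeries.ofPowerSeries_C, HahnSeries.C_apply, HahnSeries.single_mul_single, add_zero, one_mul]
  have hy0 : y ≠ 0 := by
    rw [hy]
    intro h
    have h1 := Polynomial.algebraMap_hahnSeries_injective ℤ (h.trans (map_zero _).symm)
    have h2 := congrArg (fun p : Polynomial (O k) => p.coeff 0) h1
    simp at h2
  refine IsAlgebraic.of_mul (mem_nonZeroDivisors_of_ne_zero hy0) (isAlgebraic_algebraMap _) ?_
  rw [hy', one_sub_mul_geomSeries]
  exact (mem_odagger_iff _).mp (hahnC_mem_odagger a)

/-- A coefficientwise `k`-linear map acts on a geometric series coefficientwise (both have no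
negative-degree terms). [folklore] -/
theorem mapCoeff_geomSeries_coeff_natCast (f : O k →ₗ[k] O k) (a q : O k) (n : ℕ) :
    (mapCoeff k f (geomSeries k a q)).coeff (n : ℤ) = f (a * q ^ n) := by
  rw [mapCoeff_coeff, geomSeries_coeff_natCast]

/-- Two Laurent series without negative-degree terms agree iff their `ℕ`-indexed coefficients do.
[folklore] -/
theorem hahnSeries_ext_of_natCast {F G : LaurentSeries (O k)}
    (hF : ∀ n : ℕ, F.coeff (Int.negSucc n) = 0) (hG : ∀ n : ℕ, G.coeff (Int.negSucc n) = 0)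
    (h : ∀ n : ℕ, F.coeff (n : ℤ) = G.coeff (n : ℤ)) : F = G := by
  refine HahnSeries.ext (funext fun n => ?_)
  cases n with
  | ofNat n => exact h n
  | negSucc n => rw [hF n, hG n]

/-! ### 4. The infinite-rank example and its two-variable certificate -/

variable (k) in
/-- **The example.** `oddGeom i = ∑ₙ ϖⁿ (2zᵢ - 1)^{2n+1} = (2zᵢ - 1)/(1 - ϖ(2zᵢ - 1)²)`, written as
the geometric series `w · ∑ₙ ϖⁿ (w²)ⁿ`, `w = 2zᵢ - 1`. Each coefficient is odd about `zᵢ = 1/2`,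
so `∫ = 0`; the coefficients have unbounded degree (infinite rank). [folklore] -/
def oddGeom (i : ℕ) : LaurentSeries (O k) :=
  geomSeries k (2 * zvar k i - 1) ((2 * zvar k i - 1) ^ 2)

variable (k) in
/-- **The contracting homotopy** `q = zⱼ + (1 - zⱼ)(2zᵢ - 1)²` in the auxiliary variable `zⱼ`:
`1 - ϖq` interpolates linearly between the loop `1 - ϖ(2zᵢ-1)²` (`zⱼ = 0`) and the constant
`1 - ϖ` (`zⱼ = 1`), keeping the end points `zᵢ ∈ {0, 1}` fixed. [folklore] -/
def homotopyQ (i j : ℕ) : O k :=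
  zvar k j + (1 - zvar k j) * (2 * zvar k i - 1) ^ 2

/-- The example is algebraic (indeed rational in `ϖ`). [folklore] -/
theorem oddGeom_mem_odagger (i : ℕ) : oddGeom k i ∈ Odagger k :=
  geomSeries_mem_odagger _ _

/-- Unfolding of the type (a) operator. [folklore] -/
theorem relA_apply (i : ℕ) (f : O k) : relA k i f = dz k i f - restr k i 1 f + restr k i 0 f := by
  simp only [relA, LinearMap.add_apply, LinearMap.sub_apply]

/-- **The certificate, coefficientwise**: for `i ≠ j`, `w = 2zᵢ - 1`, `q = zⱼ + (1 - zⱼ)w²` and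
every `n`,
`(∂ᵢ - |_{zᵢ=1} + |_{zᵢ=0})(-zᵢ(1-zᵢ) qⁿ) + (∂ⱼ - |_{zⱼ=1} + |_{zⱼ=0})((1-zⱼ) w qⁿ) = w (w²)ⁿ`
— a polynomial identity resting on `1 - w² = 4zᵢ(1-zᵢ)`, `∂ᵢq = 4(1-zⱼ)w`, `∂ⱼq = 1 - w²`,
`q|_{zⱼ=0} = w²`, and the vanishing of `zᵢ(1-zᵢ)` at `zᵢ ∈ {0,1}`, of `1 - zⱼ` at `zⱼ = 1`.
[folklore] -/
theorem certificate_coeff {i j : ℕ} (hij : i ≠ j) (n : ℕ) :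
    relA k i (-(zvar k i * (1 - zvar k i)) * homotopyQ k i j ^ n) +
        relA k j ((1 - zvar k j) * (2 * zvar k i - 1) * homotopyQ k i j ^ n) =
      (2 * zvar k i - 1) * ((2 * zvar k i - 1) ^ 2) ^ n := by
  have hji : j ≠ i := fun h => hij h.symm
  -- the elementary derivatives and restrictions
  have hdA : dz k i (-(zvar k i * (1 - zvar k i))) = 2 * zvar k i - 1 := by
    simp only [map_neg, dz_mul, map_sub, dz_one, dz_zvar_self]; ring
  have hdqi : dz k i (homotopyQ k i j) = 4 * (1 - zvar k j) * (2 * zvar k i - 1) := by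
    simp only [homotopyQ, map_add, dz_mul, map_sub, dz_one, dz_zvar_self, dz_zvar_of_ne hji,
      dz_pow_succ, pow_one, dz_ofNat]; ring
  have hdB : dz k j ((1 - zvar k j) * (2 * zvar k i - 1)) = -(2 * zvar k i - 1) := by
    simp only [dz_mul, map_sub, dz_one, dz_zvar_self, dz_zvar_of_ne hij, dz_ofNat]; ring
  have hdqj : dz k j (homotopyQ k i j) = 1 - (2 * zvar k i - 1) ^ 2 := by
    simp only [homotopyQ, map_add, dz_mul, map_sub, dz_one, dz_zvar_self, dz_zvar_of_ne hij,
      dz_pow_succ, pow_one, dz_ofNat]; ring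
  have hrA : ∀ c : k, c = 0 ∨ c = 1 → restr k i c (-(zvar k i * (1 - zvar k i))) = 0 := by
    rintro c (rfl | rfl) <;>
      simp only [map_neg, restr_mul, map_sub, restr_one, restr_zvar_self, map_zero, map_one] <;> ring
  have hrB1 : restr k j 1 ((1 - zvar k j) * (2 * zvar k i - 1)) = 0 := by
    simp only [restr_mul, map_sub, restr_one, restr_zvar_self, map_one]; ring
  have hrB0 : restr k j 0 ((1 - zvar k j) * (2 * zvar k i - 1)) = 2 * zvar k i - 1 := by
    simp only [restr_mul, map_sub, restr_one, restr_zvar_self, restr_zvar_of_ne hij, map_zero,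
      restr_ofNat]; ring
  have hrq0 : restr k j 0 (homotopyQ k i j) = (2 * zvar k i - 1) ^ 2 := by
    simp only [homotopyQ, map_add, restr_mul, map_sub, restr_one, restr_zvar_self,
      restr_zvar_of_ne hij, map_zero, restr_pow, restr_ofNat]; ring
  -- assemble
  simp only [relA_apply, dz_mul, restr_mul, restr_pow, hrA 0 (Or.inl rfl), hrA 1 (Or.inr rfl),
    hrB1, hrB0, hrq0, hdA, hdB, zero_mul, sub_zero, add_zero]
  cases n with
  | zero => simp only [pow_zero, map_one_of_leibniz _ (dz_mul _), mul_zero, add_zero]; ring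
  | succ m =>
    rw [dz_pow_succ, dz_pow_succ, hdqi, hdqj, pow_succ (homotopyQ k i j) m]
    generalize homotopyQ k i j ^ m = Q
    simp only [homotopyQ]
    ring

/-- **The certificate**: for `i ≠ j`,
`oddGeom i = gen_a(i, G₁) + gen_a(j, G₂)` with `G₁ = -zᵢ(1-zᵢ)/(1-ϖq)`, `G₂ = (1-zⱼ)(2zᵢ-1)/(1-ϖq)`
(both geometric, hence in `𝒪†_alg`). [folklore] -/
theorem oddGeom_eq_certificate {i j : ℕ} (hij : i ≠ j) :
    oddGeom k i =
      mapCoeff k (relA k i) (geomSeries k (-(zvar k i * (1 - zvar k i))) (homotopyQ k i j)) +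
        mapCoeff k (relA k j) (geomSeries k ((1 - zvar k j) * (2 * zvar k i - 1)) (homotopyQ k i j)) := by
  refine hahnSeries_ext_of_natCast (fun n => geomSeries_coeff_negSucc _ _ n) (fun n => ?_) (fun n => ?_)
  · rw [HahnSeries.coeff_add, mapCoeff_coeff, mapCoeff_coeff, geomSeries_coeff_negSucc,
      geomSeries_coeff_negSucc, map_zero, map_zero, add_zero]
  · rw [oddGeom, geomSeries_coeff_natCast, HahnSeries.coeff_add, mapCoeff_geomSeries_coeff_natCast,
      mapCoeff_geomSeries_coeff_natCast, certificate_coeff hij]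

/-- **Théorème 1.7, direction `⇒`, for the infinite-rank example — proved** (over any field):
`∑ₙ ϖⁿ (2zᵢ - 1)^{2n+1} ∈ span_k gens`. [Ayoub, revisited note, Théorème 1.7 (⇒), an instance
beyond finite rank] [folklore] -/
theorem oddGeom_mem_span_ayoubGenerators (i : ℕ) :
    oddGeom k i ∈ Submodule.span k (ayoubGenerators k) := by
  rw [oddGeom_eq_certificate (Nat.succ_ne_self i).symm]
  exact Submodule.add_mem _
    (Submodule.subset_span (Or.inl ⟨_, geomSeries_mem_odagger _ _, i, rfl⟩))
    (Submodule.subset_span (Or.inl ⟨_, geomSeries_mem_odagger _ _, i + 1, rfl⟩))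

/-- … and consequently `∫ ∑ₙ ϖⁿ (2zᵢ - 1)^{2n+1} = 0`, i.e. `∫₀¹ (2z-1)^{2n+1} dz = 0` for all `n`
(by the easy inclusion of Théorème 1.7). [folklore] -/
theorem intLaurent_oddGeom [CharZero k] (i : ℕ) : intLaurent k (oddGeom k i) = 0 :=
  ayoub_relativeKZ_revisited_easy k _ (oddGeom_mem_span_ayoubGenerators i)

/-! ### 5. The example has infinite rank -/

/-- **The example is outside the finite-rank theorem**: the `ϖ`-coefficients
`(2zᵢ-1)^{2n+1}` of `oddGeom i` are not supported on any finite set of monomials (their degrees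
in `zᵢ` are unbounded), so `AyoubRelativeFiniteRank.mem_span_ayoubGenerators_of_mem_supported`
does not apply to it. (Degree count through the `k`-algebra map `𝒪 → k[X]`, `zᵢ ↦ X`, all other
variables `↦ 1`.) [folklore] -/
theorem oddGeom_not_supported [CharZero k] (i : ℕ) :
    ¬ ∃ S : Finset Mono, ∀ n : ℤ,
      (oddGeom k i).coeff n ∈ AddMonoidAlgebra.supported k k (S : Set Mono) := by
  classical
  rintro ⟨S, hS⟩
  -- the degree-in-`zᵢ` homomorphism `φ : 𝒪 → k[X]`
  let ψ : Multiplicative Mono →* Polynomial k :=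
    { toFun := fun m => X ^ ((Multiplicative.toAdd m).1 i)
      map_one' := by simp
      map_mul' := fun m m' => by
        simp only [toAdd_mul, Prod.fst_add, Finsupp.add_apply, pow_add] }
  let φ : O k →ₐ[k] Polynomial k := AddMonoidAlgebra.lift k (Polynomial k) Mono ψ
  have hφ : ∀ f : O k, φ f = f.coeff.sum fun a b => b • (X : Polynomial k) ^ (a.1 i) := fun f =>
    AddMonoidAlgebra.lift_apply _ _
  -- (1) supported on `S` ⇒ degree ≤ N
  set N : ℕ := S.sup fun μ => μ.1 i with hN
  have hdeg : ∀ f ∈ AddMonoidAlgebra.supported k k (S : Set Mono), (φ f).natDegree ≤ N := by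
    intro f hf
    rw [hφ, Finsupp.sum]
    refine Polynomial.natDegree_sum_le_of_forall_le _ _ fun μ hμ => ?_
    have hμS : μ ∈ S := Finset.mem_coe.mp (AddMonoidAlgebra.mem_supported.mp hf hμ)
    exact (Polynomial.natDegree_smul_le _ _).trans
      ((Polynomial.natDegree_pow_le_of_le _ Polynomial.natDegree_X_le).trans
        ((mul_one _).le.trans (Finset.le_sup (f := fun μ : Mono => μ.1 i) hμS)))
  -- (2) the `N`-th coefficient `w (w²)^N` has degree `2N + 1`
  have hz : φ (zvar k i) = X := by
    show AddMonoidAlgebra.lift k (Polynomial k) Mono ψ (AddMonoidAlgebra.single _ 1) = X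
    rw [AddMonoidAlgebra.lift_single, one_smul]
    show X ^ ((Finsupp.single i 1 : ℕ →₀ ℕ) i) = X
    rw [Finsupp.single_eq_same, pow_one]
  have hw : φ (2 * zvar k i - 1) = 2 * X - 1 := by
    rw [map_sub, map_mul, map_ofNat, map_one, hz]
  have hwdeg : (2 * X - 1 : Polynomial k).natDegree = 1 := by compute_degree!
  have hcoeff : (φ ((oddGeom k i).coeff (N : ℤ))).natDegree = 2 * N + 1 := by
    rw [oddGeom, geomSeries_coeff_natCast, ← pow_mul, ← pow_succ', map_pow, hw,
      Polynomial.natDegree_pow, hwdeg, mul_one]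
  have := hdeg _ (hS N)
  rw [hcoeff] at this
  omega

end Literature.NumberTheory.Transcendental.AyoubRel
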